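import Summits.QuantumFields.BalabanUV.T4Continuum.Support.OutputRateFunctionalTablesComplex
import Summits.QuantumFields.BalabanUV.T4Continuum.Support.OutputRateFunctionalTablesPointwise

/-!
# OutputRateFunctionalTablesComplexPointwise — the Re∕Im road DOWN TO PER-CHART-POINT LETTERS: leaf-02's per-background slots at the two-row
# chart `𝒰 × Fin 2` with Bałaban's pointwise functional ROTATED on the rows; the END `NE5 EA EB` over the original carriers from per-chart-point
# hypotheses (complex representation identities, complex-domain decay, a real section) — the layer the substrate instantiates (Q-S16)

Cell `pub-balaban`, unit `b2b-balaban-t4-ne5-p1` (row NE5 OWNER, gen 35; owner item «g35-e», ruling R49 (4), `HOME/CLAIMS.log` l.16073 ∕ l.17188).  Summits-side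
NEW WORK under the LEAN PLACEMENT RULE (cell modelling + bookkeeping over ABSTRACT carriers; nothing printed is asserted; no `[cite:]`; no `Prop`-valued fact minted —
the two data declarations are the rotated family slots `toFamilySlotsRot` and the `abbrev` `toStepModelRot` of their step model).  HONEST FRAMING: rung (B)+1 of the FINITE-VOLUME T⁴ continuum programme — NOT infinite volume, NOT a mass
gap, NOT the Clay problem, NOT a proof of NE5 (NOT PRINTED; GAPS G-t4-U3-1).  HONEST DEPENDENCY (cell, verbatim): continuum YM on T⁴ ⇐ BetaPertH ∧ nine spine
estimates (0/9 proved); BetaPertH ⇐ (D1) ∧ (D4) ∧ CAP+tail; G-an2-4 gates asym, D1 and NE2/3/4.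

WHAT ([folklore] bookkeeping, NO estimate).  For `P : PointwiseSlots C (𝒰 × Fin 2) Op Hist` (leaf-02's part 3, p225051: operators ∕ two-row-table insertions ∕ class AT
each point `(u, i)` of the two-row chart — at the instance constant in the row index `i` — with the displayed uniform boundedness of the operator families):
* `toFamilySlotsRot P` = `P.toFamilySlots` with the pointwise functional ROTATED on the rows, `Out k o h (X,(u,i)) := (−I)^i · P.Out k o h X`
  (`toFamilySlotsRot_out`: the `hrot` of `OutputRateFunctionalTablesComplex` by `rfl`); its step model `toStepModelRot`;
* the `Out`-FREE kernel binders of `toStepModelRot` ARE those of `P.toStepModel` (the two models differ only in `Out`): `operatorRate_rot_iff`,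
  `insertionRate_rot_iff`, `insertionDamped_rot_iff`, `inBase_rot_iff` (all `Iff.rfl`), so leaf-02's pointwise transfers apply BY NAME;
* `representsB_reIm_of_pointwise` ∕ `representsA_reIm_of_pointwise`: `RepresentsB (reImTab ℰB)` from the COMPLEX identity AT EVERY POINT
  `ℰB g u X = P.Out k (P.opB g k (u,i)) (P.insB g k (tableB (reImTab ℰB) g ()) (u,i)) X` + boundedness over the chart of the ONE inserted family of record;
* `outputEnvelope_rot_of_pointwise'`: W2 of the rotated model from the pointwise envelope of `P.Out` around every admissible per-point datum;
* **`ne5_of_pointwiseSlots_reIm`** — THE END: the hypotheses of leaf-02's `ne5_of_pointwiseSlots` VERBATIM IN SHAPE but with (a) complex representation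
  identities for the two-row tables, (b) the complex-domain decay bounds `‖ℰ g u X‖ ≤ E₀·e^{−κd(X)}` ([I] (1.18) on 𝐔^c, KIND), (c) a real SECTION `ι : C.BgB → 𝒰`
  with the Re-identities INSTEAD OF a surjective chart map ⟹ `T4OutputRate.NE5 EA EB W κ θ (4G(δ+δ′)(θ−ω)∕(θ−(1+4Gc)ω))` over the ORIGINAL carriers
  (the kernel's `StepModel.ne5_of_stepModel` over `paramCarriers C (𝒰 × Fin 2)` on `toStepModelRot P` + `OutputRateFunctionalTablesComplex.ne5_of_ne5_reImTab` —
  `ne5_of_familySlots_reIm`'s own proof read one level down, W1 ∕ W4 ∕ MI-3a through leaf-02's `P`-level transfers and the `_rot_iff` identities).  The W1 input `hop` at the (complex) chart points is what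
  `OutputRateComplexSlice.operatorRate_complex_of_realSlice_all` (p225933) produces from the real-slice rate.
WHAT IS NOT HERE.  No instance (χ, ι, the term families, the per-point slots = substrate D-8 ∕ O-8 ∕ W-14); no estimate of [II].  0 sorry; axioms ⊆ {propext,
Classical.choice, Quot.sound}.
-/

noncomputable section

open scoped BigOperators ENNReal
open Finset Function Metric Set Complex

namespace Summit.QuantumFields.BalabanUV.T4Continuum.OutputRateFunctionalTablesComplexPointwise

open Literature.MathematicalPhysics.QuantumFieldTheory.Balaban1983to89
open Literature.MathematicalPhysics.QuantumFieldTheory.Balaban1983to89.T4OutputRate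
open Literature.MathematicalPhysics.QuantumFieldTheory.Balaban1983to89.T4InputCauchyRateData
open Summit.QuantumFields.BalabanUV.T4Continuum.OutputRateFunctionalTables
open Summit.QuantumFields.BalabanUV.T4Continuum.OutputRateFunctionalTablesFamily
open Summit.QuantumFields.BalabanUV.T4Continuum.OutputRateFunctionalTablesPointwise
open Summit.QuantumFields.BalabanUV.T4Continuum.OutputRateFunctionalTablesComplex

variable {C : Carriers} {𝒰 : Type} {Op Hist : Type*} [NormedAddCommGroup Op] [NormedSpace ℂ Op] [NormedAddCommGroup Hist]
  [NormedSpace ℂ Hist]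

variable (P : PointwiseSlots C (𝒰 × Fin 2) Op Hist)

/-! ## §1 The rotated family slots of per-point slots on the two-row chart -/

/-- [folklore] DATA: **THE ROTATED FAMILY SLOTS** — leaf-02's `toFamilySlots` (operator families by the displayed uniform bounds, inserted families through
`famOf`, a family admissible iff admissible at every point) with Bałaban's pointwise functional ROTATED on the two rows:
`Out k o h (X,(u,i)) := (−I)^i · P.Out k o h X`, so that `Re Out` delivers `Re` on row `0` and `Im` on row `1`. -/
def toFamilySlotsRot : FamilySlots C (𝒰 × Fin 2) Op Hist where
  Out k o h p := (-I) ^ (p.2.2 : ℕ) * P.Out k o h p.1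
  opA g k := ⟨fun w => P.opA g k w, memℓp_infty (P.opA_bdd g k)⟩
  opB g k := ⟨fun w => P.opB g k w, memℓp_infty (P.opB_bdd g k)⟩
  insA g k t := famOf (P.insA g k t)
  insB g k t := famOf (P.insB g k t)
  Base k g := {p | ∀ w, (p.1 w, p.2 w) ∈ P.Base k g w}
  rOp := P.rOp
  rHist := P.rHist
  rOp_pos := P.rOp_pos
  rHist_pos := P.rHist_pos

/-- [folklore] The step model of the rotated family slots over `paramCarriers C (𝒰 × Fin 2)`. -/
abbrev toStepModelRot : StepModel (paramCarriers C (𝒰 × Fin 2)) (Fam (𝒰 × Fin 2) Op) (Fam (𝒰 × Fin 2) Hist) :=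
  (toFamilySlotsRot P).toStepModel

/-- [folklore] The rotation identity `hrot` of `OutputRateFunctionalTablesComplex`, by `rfl`. -/
theorem toFamilySlotsRot_out (k : ℕ) (o : Op) (h : Hist) (p : C.Dom × (𝒰 × Fin 2)) :
    (toFamilySlotsRot P).Out k o h p = (-I) ^ (p.2.2 : ℕ) * P.Out k o h p.1 := rfl

/-! ## §2 The `Out`-free kernel binders coincide with those of leaf-02's model -/

/-- [folklore] W1 of the rotated model IS W1 of leaf-02's model (same operator families and margins). -/
theorem operatorRate_rot_iff (W : Set (ℕ → ℝ)) (δ θ : ℝ) :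
    (toStepModelRot P).OperatorRate W δ θ ↔ P.toStepModel.OperatorRate W δ θ := Iff.rfl

/-- [folklore] The two runs' insertion rate of the rotated model IS that of leaf-02's model. -/
theorem insertionRate_rot_iff (W : Set (ℕ → ℝ)) (κ E₀ δ' θ : ℝ) :
    (toStepModelRot P).InsertionRate W κ E₀ δ' θ ↔ P.toStepModel.InsertionRate W κ E₀ δ' θ := Iff.rfl

/-- [folklore] The damped-Lipschitz binder of the rotated model IS that of leaf-02's model. -/
theorem insertionDamped_rot_iff (W : Set (ℕ → ℝ)) (κ c ω : ℝ) :
    (toStepModelRot P).InsertionDamped W κ c ω ↔ P.toStepModel.InsertionDamped W κ c ω := Iff.rfl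

/-- [folklore] Admissibility in the rotated model IS admissibility in leaf-02's model (same data maps and class). -/
theorem inBase_rot_iff (EB : Functional (paramCarriers C (𝒰 × Fin 2)) (paramCarriers C (𝒰 × Fin 2)).BgB) (W : Set (ℕ → ℝ)) :
    (toStepModelRot P).InBase EB W ↔ P.toStepModel.InBase EB W := Iff.rfl

/-! ## §3 Representation of the two-row tables and the envelope, from per-point hypotheses -/

/-- [folklore] **`RepresentsB` OF RUN B's TWO-ROW TABLE FROM THE COMPLEX IDENTITY AT EVERY POINT** ([II] (2.13) with (1.33) on the complex chart): if run B's
inserted family of record (the insertion of its own two-row table) is bounded over the chart and, at every point `(u, i)`, run B's COMPLEX term `ℰB g u X` IS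
Bałaban's functional at run B's operators AT `(u,i)` and at the insertion of run B's two-row table AT `(u,i)`, then the rotated model represents `reImTab ℰB`. -/
theorem representsB_reIm_of_pointwise {ℰB : (ℕ → ℝ) → 𝒰 → C.Dom → ℂ} {W : Set (ℕ → ℝ)}
    (hbd : ∀ g ∈ W, ∀ k, BddAbove (Set.range fun w => ‖P.insB g k (tableB (reImTab (C := C) ℰB) g PUnit.unit) w‖))
    (h : ∀ g ∈ W, ∀ (X : C.Dom) (u : 𝒰) (i : Fin 2), ℰB g u X =
      P.Out (C.scale X) (P.opB g (C.scale X) (u, i)) (P.insB g (C.scale X) (tableB (reImTab (C := C) ℰB) g PUnit.unit) (u, i)) X) :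
    (toStepModelRot P).RepresentsB (reImTab ℰB) W := by
  refine representsB_reIm_of_complex (toFamilySlotsRot P) P.Out (toFamilySlotsRot_out P) fun g hg X u i => ?_
  show ℰB g u X = P.Out (C.scale X) (P.opB g (C.scale X) (u, i))
    (famOf (P.insB g (C.scale X) (tableB (reImTab (C := C) ℰB) g PUnit.unit)) (u, i)) X
  rw [famOf_apply (hbd g hg _)]
  exact h g hg X u i

/-- [folklore] The same for run A (its complex family supplied already read at the transported chart points). -/
theorem representsA_reIm_of_pointwise {ℰA : (ℕ → ℝ) → 𝒰 → C.Dom → ℂ} {W : Set (ℕ → ℝ)}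
    (hbd : ∀ g ∈ W, ∀ k, BddAbove (Set.range fun w => ‖P.insA g k (tableA (reImTab (C := C) ℰA) g PUnit.unit) w‖))
    (h : ∀ g ∈ W, ∀ (X : C.Dom) (u : 𝒰) (i : Fin 2), ℰA g u X =
      P.Out (C.scale X) (P.opA g (C.scale X) (u, i)) (P.insA g (C.scale X) (tableA (reImTab (C := C) ℰA) g PUnit.unit) (u, i)) X) :
    (toStepModelRot P).RepresentsA (reImTab ℰA) W := by
  refine representsA_reIm_of_complex (toFamilySlotsRot P) P.Out (toFamilySlotsRot_out P) fun g hg X u i => ?_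
  show ℰA g u X = P.Out (C.scale X) (P.opA g (C.scale X) (u, i))
    (famOf (P.insA g (C.scale X) (tableA (reImTab (C := C) ℰA) g PUnit.unit)) (u, i)) X
  rw [famOf_apply (hbd g hg _)]
  exact h g hg X u i

/-- [folklore] `InBase` of the two-row table's data from admissibility AT every point (run B's inserted family bounded over the chart). -/
theorem inBase_reIm_of_pointwise {ℰB : (ℕ → ℝ) → 𝒰 → C.Dom → ℂ} {W : Set (ℕ → ℝ)}
    (hbd : ∀ g ∈ W, ∀ k, BddAbove (Set.range fun w => ‖P.insB g k (tableB (reImTab (C := C) ℰB) g PUnit.unit) w‖))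
    (h : ∀ k, ∀ g ∈ W, ∀ w, (P.opB g k w, P.insB g k (tableB (reImTab (C := C) ℰB) g PUnit.unit) w) ∈ P.Base k g w) :
    (toStepModelRot P).InBase (reImTab ℰB) W := by
  intro k g hg _ w
  show (P.opB g k w, famOf (P.insB g k (tableB (reImTab (C := C) ℰB) g PUnit.unit)) w) ∈ P.Base k g w
  rw [famOf_apply (hbd g hg k)]
  exact h k g hg w

/-- [folklore] **W2 OF THE ROTATED MODEL FROM THE POINTWISE ENVELOPE OF BAŁABAN's FUNCTIONAL** around every admissible per-point datum (`‖(−I)^i‖ = 1`). -/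
theorem outputEnvelope_rot_of_pointwise' {W : Set (ℕ → ℝ)} {κ G : ℝ}
    (h : ∀ k, ∀ g ∈ W, ∀ w, ∀ q ∈ P.Base k g w, ∀ X : C.Dom, C.scale X = k →
      DifferentiableOn ℂ (fun z : Op × Hist => P.Out k z.1 z.2 X) (closedBall q.1 (P.rOp k) ×ˢ closedBall q.2 (P.rHist k)) ∧
        ∀ z ∈ closedBall q.1 (P.rOp k) ×ˢ closedBall q.2 (P.rHist k), ‖P.Out k z.1 z.2 X‖ ≤ G * Real.exp (-(κ * C.d X))) :
    (toStepModelRot P).OutputEnvelope W κ G :=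
  outputEnvelope_rot_of_pointwise (toFamilySlotsRot P) P.Out (toFamilySlotsRot_out P) fun k g hg _ hp X w hX => h k g hg w _ (hp w) X hX

/-! ## §4 END: NE5 over the original carriers from per-chart-point hypotheses on the complex two-row chart -/

/-- [folklore] **END — `T4OutputRate.NE5 EA EB` OVER THE ORIGINAL CARRIERS FROM PER-CHART-POINT SLOTS ON THE COMPLEX TWO-ROW CHART.**  Per-point slots whose
per-point hypotheses hold uniformly over the chart — the two runs' COMPLEX term families represented at every point (two-row function tables READ; the two
inserted families of record bounded over the chart), run B's data admissible at every point, the output envelope of Bałaban's functional around every admissible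
per-point datum, the complex-domain decay bounds, the operator rate AT every (complex) chart point (from the real-slice rate by `OutputRateComplexSlice`), the
insertion rate and the damped-Lipschitz binder AT every point, the kernel's smallness — and a real SECTION `ι` of the chart on which the two runs' functionals of
record are the Re-rows ⟹ `NE5 EA EB W κ θ C₅` with the kernel's constant.  No kernel twin, no surjectivity. -/
theorem ne5_of_pointwiseSlots_reIm [Nonempty 𝒰] {ℰA ℰB : (ℕ → ℝ) → 𝒰 → C.Dom → ℂ} {EA : Functional C C.BgA}
    {EB : Functional C C.BgB} {W : Set (ℕ → ℝ)} {κ G E₀ δ δ' θ c ω : ℝ}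
    (hbdA : ∀ g ∈ W, ∀ k, BddAbove (Set.range fun w => ‖P.insA g k (tableA (reImTab (C := C) ℰA) g PUnit.unit) w‖))
    (hbdB : ∀ g ∈ W, ∀ k, BddAbove (Set.range fun w => ‖P.insB g k (tableB (reImTab (C := C) ℰB) g PUnit.unit) w‖))
    (hrA : ∀ g ∈ W, ∀ (X : C.Dom) (u : 𝒰) (i : Fin 2), ℰA g u X =
      P.Out (C.scale X) (P.opA g (C.scale X) (u, i)) (P.insA g (C.scale X) (tableA (reImTab (C := C) ℰA) g PUnit.unit) (u, i)) X)
    (hrB : ∀ g ∈ W, ∀ (X : C.Dom) (u : 𝒰) (i : Fin 2), ℰB g u X =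
      P.Out (C.scale X) (P.opB g (C.scale X) (u, i)) (P.insB g (C.scale X) (tableB (reImTab (C := C) ℰB) g PUnit.unit) (u, i)) X)
    (hbase : ∀ k, ∀ g ∈ W, ∀ w, (P.opB g k w, P.insB g k (tableB (reImTab (C := C) ℰB) g PUnit.unit) w) ∈ P.Base k g w)
    (henv : ∀ k, ∀ g ∈ W, ∀ w, ∀ q ∈ P.Base k g w, ∀ X : C.Dom, C.scale X = k →
      DifferentiableOn ℂ (fun z : Op × Hist => P.Out k z.1 z.2 X) (closedBall q.1 (P.rOp k) ×ˢ closedBall q.2 (P.rHist k)) ∧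
        ∀ z ∈ closedBall q.1 (P.rOp k) ×ˢ closedBall q.2 (P.rHist k), ‖P.Out k z.1 z.2 X‖ ≤ G * Real.exp (-(κ * C.d X)))
    (hdA : ∀ g ∈ W, ∀ (u : 𝒰) (X : C.Dom), ‖ℰA g u X‖ ≤ G * Real.exp (-(κ * C.d X)))
    (hdB : ∀ g ∈ W, ∀ (u : 𝒰) (X : C.Dom), ‖ℰB g u X‖ ≤ E₀ * Real.exp (-(κ * C.d X))) (hE₀ : E₀ ≤ G)
    (hop : ∀ k, ∀ g ∈ W, ∀ w : 𝒰 × Fin 2, ‖P.opA g k w - P.opB g k w‖ ≤ δ * θ ^ k * P.rOp k)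
    (hins : ∀ k, ∀ g ∈ W, ∀ (t : C.Dom × (𝒰 × Fin 2) → ℝ), (∀ Y w, |t (Y, w)| ≤ E₀ * Real.exp (-(κ * C.d Y))) →
      ∀ w, ‖P.insA g k t w - P.insB g k t w‖ ≤ δ' * θ ^ k * P.rHist k)
    (hdamp : ∀ k, ∀ g ∈ W, ∀ (t t' : C.Dom × (𝒰 × Fin 2) → ℝ) (D : ℕ → ℝ), (∀ j < k, 0 ≤ D j) →
      (∀ Y, C.scale Y < k → ∀ w, |t (Y, w) - t' (Y, w)| ≤ D (C.scale Y) * Real.exp (-(κ * C.d Y))) →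
        ∀ w, ‖P.insA g k t w - P.insA g k t' w‖ ≤ P.rHist k * (c * ∑ j ∈ range k, ω ^ (k - j) * D j))
    (hG : 0 ≤ G) (hδ : 0 ≤ δ + δ') (hc : 0 ≤ c) (hω : 0 ≤ ω) (hsmall : (1 + 4 * G * c) * ω < θ)
    (ι : C.BgB → 𝒰) (hιA : ∀ g ∈ W, ∀ (U : C.BgB) (X : C.Dom), EA g (C.transport U) X = (ℰA g (ι U) X).re)
    (hιB : ∀ g ∈ W, ∀ (U : C.BgB) (X : C.Dom), EB g U X = (ℰB g (ι U) X).re) :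
    NE5 EA EB W κ θ (4 * G * (δ + δ') * (θ - ω) / (θ - (1 + 4 * G * c) * ω)) :=
  ne5_of_ne5_reImTab ι hιA hιB
    ((toStepModelRot P).ne5_of_stepModel ((representsA_reIm_of_pointwise P) hbdA hrA) ((representsB_reIm_of_pointwise P) hbdB hrB)
      ((inBase_reIm_of_pointwise P) hbdB hbase) ((outputEnvelope_rot_of_pointwise' P) henv) (decayBound_reImTab hdA)
      (decayBound_reImTab hdB) hE₀ (((operatorRate_rot_iff P) W δ θ).2 (P.operatorRate_of_pointwise hop))
      (((insertionRate_rot_iff P) W κ E₀ δ' θ).2 (P.insertionRate_of_pointwise hins))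
      (((insertionDamped_rot_iff P) W κ c ω).2 (P.insertionDamped_of_pointwise hdamp)) hG hδ hc hω hsmall)

end Summit.QuantumFields.BalabanUV.T4Continuum.OutputRateFunctionalTablesComplexPointwise

end
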